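import Literature.NumberTheory.EllipticCurves.DeligneSerreWeightOneIrreducible
import Literature.NumberTheory.EllipticCurves.DeligneSerreRankinProofs
import Literature.NumberTheory.EllipticCurves.DeligneSerreRankinProp51Proofs
import Literature.NumberTheory.GaloisRepresentations.FrobeniusDensityTheorem
import Literature.NumberTheory.EllipticCurves.KummerUnramified
import Literature.NumberTheory.LFunctions.ChebotarevDensity
import Literature.NumberTheory.Automorphic.LanglandsTunnellLSeriesProofs
import Literature.NumberTheory.EllipticCurves.DeligneSerreProp27Proofs
import Literature.NumberTheory.EllipticCurves.DeligneSerreProp27WeightReductionProofs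
import Mathlib.RingTheory.RootsOfUnity.Complex
import Mathlib.RingTheory.Polynomial.Cyclotomic.Roots
import HarnessLib

/-!
# Deligne–Serre 1974, Thm. 4.1 (irreducibility) without the Chebotarev density theorem

This file proves the named fact
`Literature.NumberTheory.EllipticCurves.ModularForms.DeligneSerre1974.thm41_isIrreducible`
(`NewformGaloisRepProofs`; Deligne–Serre 1974, Thm. 4.1, second assertion: the finite-image
representation `ρ : Gal(ℚ̄/ℚ) → GL₂(ℂ)` attached to a weight-one newform `f ∈ S_1(Γ₁(N))` away
from `N` is irreducible) from the single named fact

* `Literature.NumberTheory.EllipticCurves.ModularForms.DeligneSerre1974.prop27_conj`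
  (op. cit. Prop. 2.7, (2.7.4): conjugates `σ(f)` of eigenforms are eigenforms, with eigenvalues
  `σ(a_p)`; in the tree a consequence of (2.7.2), `prop27_conj_of_span_integralLattice1`),

everything else being proved in the tree: Prop. 5.1 (`prop51_holds`, Rankin), Frobenius' density
theorem on split primes (`hasStrongDirichletDensity_splitPrimes`), the newform facts
`f ∈ S_1(N, ε)`, `T_p f = a_p f` (`…_holds`). The tree's earlier proof
`thm41_isIrreducible_of` (`DeligneSerreWeightOneIrreducible`) follows the printed §8.7 and needs
the Chebotarev density theorem (`LFunctions.Chebotarev.dirichletDensity_eq`, a named fact) twice: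
for the oddness `det ρ(c) = -1` (Lemme 3.2) and for `∑_p χ₁χ₂⁻¹(F_p) p^{-s} = O(1)` ("[21],
VI.4.2", i.e. class field theory over `ℚ` and Dirichlet's theorem). Here both uses are avoided:

* `thm41_isIrreducible_of_prop27_conj'` : `prop27_conj → thm41_isIrreducible`;
* `thm41_isIrreducible_of_span_integralLattice1` (from (2.7.2) in all weights) and
  `thm41_isIrreducible_of_span_integralLattice1_two_le` (from (2.7.2) in weights `≥ 2` only,
  Shimura 1971, Thm. 3.52, via `DeligneSerre1974_span_integralLattice1.of_two_le`).

## The argument (op. cit. 8.7, averaged over conjugates as in the proof of Prop. 5.5)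

Suppose `ρ` reducible; it has finite image, so `ρ ≃ χ₁ ⊕ χ₂` and `a_p = χ₁(F_p) + χ₂(F_p)` for
`p ∤ N` (`exists_characters_of_not_isIrreducible`), the values being `n`-th roots of unity,
`n = #ρ(Γ_ℚ)`. Put `ψ = χ₁χ₂⁻¹`.

1. If `ψ = 1` then `|a_p|² = 4` for all `p ∤ N` and `∑_{p∤N} |a_p|² p^{-s} ∼ 4 log (1/(s-1))`
   contradicts Rankin's bound (5.1.1) `∑ |a_p|² p^{-s} ≤ log (1/(s-1)) + O(1)` for `f`
   (no parity argument is needed).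
2. Otherwise, for every `u ∈ (ℤ/nℤ)ˣ` the embedding `σ_u : ℚ(ζ_n) → ℂ`, `ζ_n ↦ ζ_n^u`
   (`exists_ringHom_apply_rootOfUnity_eq_pow`) and (2.7.4) give a weight-one eigenform `σ_u(f)`
   with `T_p σ_u(f) = (χ₁(F_p)^u + χ₂(F_p)^u) σ_u(f)` ("les `σ(a_p)` sont également valeurs propres
   des `T_p` en poids 1", proof of Prop. 5.5), hence by (5.1.1) for each `σ_u(f)`, summed over `u`,
   `∑_p ∑_u |1 + ψ(F_p)^u|² p^{-s} ≤ φ(n) log (1/(s-1)) + O(1)`.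
3. By Möbius inversion, `∑_{u ∈ (ℤ/nℤ)ˣ} ω^u = ∑_{e ∣ n} μ(e) (n/e) [ω^e = 1]` for `ω^n = 1`
   (`sum_units_pow_eq_sum_divisors_moebius`), so
   `∑_u |1 + ψ(F_p)^u|² = 2φ(n) + 2 ∑_{e∣n} μ(e)(n/e)·[ψ(F_p)^e = 1]`.
4. The set of `p` with `ψ(F_p)^e = 1` is, up to finitely many primes, the set of primes splitting
   completely in `ℚ̄^{ψ⁻¹(G[e])}`, `G = ψ(Γ_ℚ)`, so it has Dirichlet density `#G[e]/#G` by
   Frobenius' theorem (`hasDirichletDensity_frobPrimes_subgroup`, from the tree's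
   `hasStrongDirichletDensity_splitPrimes`: only the pole of Dedekind zeta functions is used, not
   Chebotarev's theorem); and `∑_{e∣n} μ(e)(n/e) #G[e] = ∑_{ω ∈ G} ∑_u ω^u = ∑_u ∑_ω ω = 0` as
   `G ≠ 1` (`sum_divisors_moebius_mul_card_eq_zero`).
5. Hence `∑_p ∑_u |a_p(σ_u f)|² p^{-s} ∼ 2φ(n) log (1/(s-1))`, contradicting step 2
   (`false_of_rankin_bound_sum`).

## Other results

* `LFunctions.HasStrongDirichletDensity.hasDirichletDensity_rat`: strong Dirichlet density of a
  set of primes of `𝓞 ℚ` gives Dirichlet density (`HasDirichletDensity`) of the corresponding set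
  of rational primes.
* The dictionary `Γ_F → Gal(L/F)` (Mathlib `AlgEquiv.restrictNormalHom`) for a finite normal
  `L ⊆ F̄`: Frobenius restricts to Frobenius (`isArithFrobAt_restrictHom`),
  inertia into inertia (`restrictHom_mem_inertia`).
* `GaloisRepresentations.hasStrongDirichletDensity_setOf_frobenius_mem` (any number field `F`)
  and `LFunctions.Chebotarev.hasDirichletDensity_frobPrimes_of_normal` /
  `hasDirichletDensity_frobPrimes_subgroup` (`F = ℚ`): the case of the Chebotarev density theorem
  (`LFunctions.Chebotarev.dirichletDensity_eq`, Neukirch VII (13.4)) where the conjugation-stable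
  set is a normal subgroup `H` — `frobPrimes φ H` has density `#H/#G` — proved from Frobenius'
  theorem.

## References

* P. Deligne, J.-P. Serre, *Formes modulaires de poids 1*, Ann. Sci. ÉNS (4) 7 (1974), 507–530:
  Thm. 4.1, Prop. 2.7 (2.7.4), Prop. 5.1, proof of Prop. 5.5, §8.7. [DeligneSerreASENS1974]
* D. A. Marcus, *Number Fields*, 2nd ed., Springer 2018, Ch. 7, Thm. 43 (split primes have
  density `1/[L:K]`); Ch. 4, Thm. 32 ff. (Frobenius). [Marcus2018]
* J. Neukirch, *Algebraic Number Theory*, Springer 1999, VII (13.4). [NeukirchANT1999]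

## Design notes

* No new named fact is introduced (D-0026): the file only proves theorems; the hypotheses of the
  main theorem are existing named facts of the tree (`prop27_conj`, resp.
  `DeligneSerre1974_span_integralLattice1`).
* The Galois-theoretic density statement is proved over a general number field `F`
  (`hasStrongDirichletDensity_setOf_frobenius_mem`) and only then specialised to `ℚ`, so that no
  intermediate field of `ℚ̄/ℚ` is ever given the `ℚ`-algebra structure `DivisionRing.toRatAlgebra`
  by instance search (cf. the design note of `GaloisRepresentations/QuadraticInertia`).
-/

noncomputable section

open Filter Topology NumberField IsDedekindDomain Rat.HeightOneSpectrum

section RatBridge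

open scoped Classical

namespace Literature.NumberTheory.LFunctions

/-- The absolute norm of the prime `𝔭_v` of `𝓞 ℚ` is the rational prime `p` attached to `v` by
Mathlib's `Rat.HeightOneSpectrum.primesEquiv` (the positive generator of `𝔭_v ∩ ℤ`). [folklore] -/
theorem absNorm_asIdeal_eq_primesEquiv (v : HeightOneSpectrum (𝓞 ℚ)) :
    Ideal.absNorm v.asIdeal = ((primesEquiv v : Nat.Primes) : ℕ) := by
  change Ideal.absNorm v.asIdeal = natGenerator v
  set e : 𝓞 ℚ ≃+* ℤ := Rat.IsIntegralClosure.intEquiv (𝓞 ℚ) with he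
  have h1 : Nat.card (𝓞 ℚ ⧸ v.asIdeal) = Nat.card (ℤ ⧸ v.asIdeal.map e) :=
    Nat.card_congr (Ideal.quotientEquiv v.asIdeal (v.asIdeal.map e) e rfl).toEquiv
  rw [Ideal.absNorm_apply, Submodule.cardQuot_apply, h1, ← Submodule.cardQuot_apply,
    ← Ideal.absNorm_apply, ← span_natGenerator, Ideal.absNorm_span_natCast, Module.finrank_self,
    pow_one]

/-- The primes of `𝓞 ℚ` of norm `p` (a rational prime): exactly the one prime `𝔭_p`. [folklore] -/
theorem primesOfNorm_rat (p : Nat.Primes) :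
    primesOfNorm ℚ p = {primesEquiv.symm p} := by
  ext v
  rw [mem_primesOfNorm, Finset.mem_singleton, absNorm_asIdeal_eq_primesEquiv,
    Equiv.eq_symm_apply]
  exact ⟨fun h => Subtype.ext h, fun h => congrArg Subtype.val h⟩

/-- Over `ℚ`, `#{𝔮 ∈ X : N𝔮 = p}` is the indicator of `𝔭_p ∈ X`. [folklore] -/
theorem primeNormCount_rat (X : Set (HeightOneSpectrum (𝓞 ℚ))) (p : Nat.Primes) :
    (primeNormCount ℚ X p : ℝ) = if primesEquiv.symm p ∈ X then 1 else 0 := by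
  rw [primeNormCount, primesOfNorm_rat, Finset.filter_singleton]
  split_ifs <;> simp

/-- **From strong Dirichlet density over `ℚ` to Dirichlet density of a set of rational primes.**
If the set `X` of primes of `𝓞 ℚ` has strong Dirichlet density `c` (convergent remainder), then
the corresponding set of rational primes has Dirichlet density `c` in the sense of
`HasDirichletDensity` (ratio to `log (1/(s-1))` tends to `c`). [folklore] -/
theorem HasStrongDirichletDensity.hasDirichletDensity_rat {X : Set (HeightOneSpectrum (𝓞 ℚ))}
    {c : ℝ} (h : HasStrongDirichletDensity ℚ X c) :
    HasDirichletDensity {p : ℕ | ∃ hp : p.Prime, primesEquiv.symm ⟨p, hp⟩ ∈ X} c := by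
  obtain ⟨L, hL⟩ := h
  set Y : Set ℕ := {p : ℕ | ∃ hp : p.Prime, primesEquiv.symm ⟨p, hp⟩ ∈ X} with hY
  -- the prime series of the count is the prime sum of `Y`
  have hser : ∀ s : ℝ, primeSeries (fun p => (primeNormCount ℚ X p : ℝ)) s =
      ∑' p : ℕ, (if p.Prime ∧ p ∈ Y then (p : ℝ) ^ (-s) else 0) := by
    intro s
    rw [primeSeries_def]
    have h2 : ∑' p : ℕ, (if p.Prime ∧ p ∈ Y then (p : ℝ) ^ (-s) else 0) =
        ∑' p : (setOf Nat.Prime : Set ℕ),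
          (if ((p : ℕ) ∈ Y) then ((p : ℕ) : ℝ) ^ (-s) else 0) := by
      rw [tsum_subtype (setOf Nat.Prime) fun p : ℕ => if p ∈ Y then (p : ℝ) ^ (-s) else 0]
      refine tsum_congr fun p => ?_
      simp only [Set.indicator_apply, Set.mem_setOf_eq]
      by_cases hp : p.Prime
      · simp [hp]
      · simp [hp]
    rw [h2]
    refine tsum_congr fun p => ?_
    have hp : (p : ℕ).Prime := p.2
    have hpe : (⟨(p : ℕ), hp⟩ : Nat.Primes) = p := Subtype.ext rfl
    rw [primeNormCount_rat]
    have hiff : primesEquiv.symm p ∈ X ↔ (p : ℕ) ∈ Y := by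
      simp only [hY, Set.mem_setOf_eq]
      constructor
      · intro h
        exact ⟨hp, by rw [hpe]; exact h⟩
      · rintro ⟨_, h⟩
        rw [hpe] at h
        exact h
    by_cases hX : primesEquiv.symm p ∈ X
    · rw [if_pos hX, one_mul, if_pos (hiff.mp hX)]
    · rw [if_neg hX, zero_mul, if_neg (fun h => hX (hiff.mpr h))]
  -- `(F(s) + c log (s-1)) / log (1/(s-1)) → 0`, and `c log (s-1) / log (1/(s-1)) = -c`
  unfold HasDirichletDensity
  have hA : Tendsto (fun s : ℝ => (primeSeries (fun p => (primeNormCount ℚ X p : ℝ)) s +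
      c * Real.log (s - 1)) / Real.log (1 / (s - 1))) (𝓝[>] (1 : ℝ)) (𝓝 0) :=
    hL.div_atTop PrimeSum.tendsto_log_one_div_sub_one
  have h := hA.add_const c
  rw [zero_add] at h
  refine h.congr' ?_
  filter_upwards [PrimeSum.eventually_log_pos] with s hs
  rw [hser s]
  have hM : Real.log (1 / (s - 1)) = -Real.log (s - 1) := by rw [one_div, Real.log_inv]
  rw [hM] at hs ⊢
  have hne : Real.log (s - 1) ≠ 0 := by intro h0; rw [h0, neg_zero] at hs; exact lt_irrefl _ hs
  field_simp
  ring

end Literature.NumberTheory.LFunctions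


/-! ### Restriction from `Γ_F` to a finite normal subextension `L ⊆ F̄` -/

namespace Literature.NumberTheory.GaloisRepresentations

open Field

section RestrictHom

universe u

variable {F : Type u} [Field F] (L : IntermediateField F (AlgebraicClosure F)) [Normal F L]

/-- The kernel of the restriction `Γ_F → Gal(L/F)` (Mathlib `AlgEquiv.restrictNormalHom`) is
`Gal(F̄/L)`. [folklore] -/
theorem absoluteGaloisGroup.restrictNormalHom_eq_one_iff (γ : absoluteGaloisGroup F) :
    AlgEquiv.restrictNormalHom L (absoluteGaloisGroup.toAlgEquiv F γ) = 1 ↔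
      γ ∈ (L.fixingSubgroup : Subgroup (absoluteGaloisGroup F)) := by
  have hr : ∀ x : L, ((AlgEquiv.restrictNormalHom L (absoluteGaloisGroup.toAlgEquiv F γ) x : L) :
      AlgebraicClosure F) = γ • (x : AlgebraicClosure F) :=
    fun x => AlgEquiv.restrictNormalHom_apply L _ x
  rw [mem_fixingSubgroup_iff_forall_smul]
  constructor
  · intro h x
    rw [← hr x, h, AlgEquiv.one_apply]
  · intro h
    ext x
    rw [hr x, AlgEquiv.one_apply]
    exact h x

end RestrictHom

section RestrictFrobenius

universe u

variable {F : Type u} [Field F] (L : IntermediateField F (AlgebraicClosure F))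

/-- A prime `𝔓` of `\bar ℤ_F` above `v` contracts to a prime of `𝓞 L` above `v`. [folklore] -/
theorem comap_ringOfIntegersToIntegralClosure_mem_primesOver {v : HeightOneSpectrum (𝓞 F)}
    {𝔓 : Ideal (absIntegers (𝓞 F) F)} (h𝔓 : 𝔓 ∈ v.primesAbove) :
    𝔓.comap (EllipticCurves.ringOfIntegersToIntegralClosure L) ∈ v.asIdeal.primesOver (𝓞 L) := by
  haveI : 𝔓.IsPrime := h𝔓.1
  haveI : 𝔓.LiesOver v.asIdeal := h𝔓.2
  set ι := EllipticCurves.ringOfIntegersToIntegralClosure (k := F) (Ω := AlgebraicClosure F) L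
  have hιalg : ∀ r : 𝓞 F, ι (algebraMap (𝓞 F) (𝓞 L) r) =
      algebraMap (𝓞 F) (absIntegers (𝓞 F) F) r := fun r => rfl
  refine ⟨Ideal.comap_isPrime ι 𝔓, ⟨?_⟩⟩
  ext r
  rw [h𝔓.2.over, Ideal.under, Ideal.under, Ideal.mem_comap, Ideal.mem_comap, Ideal.mem_comap]
  exact (Iff.of_eq (congrArg (· ∈ 𝔓) (hιalg r))).symm

variable [Normal F L]

/-- **Inertia restricts into inertia**: `I_𝔓 ≤ Γ_F` maps into the inertia group of `𝔓 ∩ 𝓞 L`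
in `Gal(L/F)`. [folklore] -/
theorem restrictHom_mem_inertia {𝔓 : Ideal (absIntegers (𝓞 F) F)} {g : absoluteGaloisGroup F}
    (hg : g ∈ 𝔓.inertia (absoluteGaloisGroup F)) :
    AlgEquiv.restrictNormalHom L (absoluteGaloisGroup.toAlgEquiv F g) ∈
      (𝔓.comap (EllipticCurves.ringOfIntegersToIntegralClosure L)).inertia (L ≃ₐ[F] L) := by
  set ι := EllipticCurves.ringOfIntegersToIntegralClosure (k := F) (Ω := AlgebraicClosure F) L
  intro y
  change AlgEquiv.restrictNormalHom L (absoluteGaloisGroup.toAlgEquiv F g) • y - y ∈ Ideal.comap ι 𝔓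
  rw [Ideal.mem_comap]
  have h1 : ι (AlgEquiv.restrictNormalHom L (absoluteGaloisGroup.toAlgEquiv F g) • y) = g • ι y := by
    apply Subtype.ext
    rw [integralClosure.coe_smul, EllipticCurves.coe_ringOfIntegersToIntegralClosure,
      EllipticCurves.coe_ringOfIntegersToIntegralClosure]
    exact AlgEquiv.restrictNormalHom_apply L _ y
  have hsub : ι (AlgEquiv.restrictNormalHom L (absoluteGaloisGroup.toAlgEquiv F g) • y - y) = g • ι y - ι y :=
    (map_sub ι _ _).trans (by rw [h1])
  exact hsub ▸ hg (ι y)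

variable [NumberField F] [IsGalois F L] [NumberField L]

/-- **Frobenius restricts to Frobenius**: if `Φ ∈ Γ_F` is an arithmetic Frobenius at the prime
`𝔓` of `\bar ℤ_F` above `v`, then `Φ|_L` is an arithmetic Frobenius of `L/F` at `𝔓 ∩ 𝓞 L`
(Serre, *Corps locaux*, I §7, Prop. 22). [folklore] -/
theorem isArithFrobAt_restrictHom {v : HeightOneSpectrum (𝓞 F)}
    {𝔓 : Ideal (absIntegers (𝓞 F) F)} (h𝔓 : 𝔓 ∈ v.primesAbove) {Φ : absoluteGaloisGroup F}
    (hΦ : IsArithFrobAt (𝓞 F) Φ 𝔓) :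
    IsArithFrobAt (𝓞 F) (AlgEquiv.restrictNormalHom L (absoluteGaloisGroup.toAlgEquiv F Φ))
      (𝔓.comap (EllipticCurves.ringOfIntegersToIntegralClosure L)) := by
  haveI : 𝔓.IsPrime := h𝔓.1
  set ι := EllipticCurves.ringOfIntegersToIntegralClosure (k := F) (Ω := AlgebraicClosure F) L
  have hQ := comap_ringOfIntegersToIntegralClosure_mem_primesOver L h𝔓
  intro y
  rw [MulSemiringAction.toAlgHom_apply]
  have h1 : ι (AlgEquiv.restrictNormalHom L (absoluteGaloisGroup.toAlgEquiv F Φ) • y) = Φ • ι y := by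
    apply Subtype.ext
    rw [integralClosure.coe_smul, EllipticCurves.coe_ringOfIntegersToIntegralClosure,
      EllipticCurves.coe_ringOfIntegersToIntegralClosure]
    exact AlgEquiv.restrictNormalHom_apply L _ y
  have h3 : 𝔓.under (𝓞 F) = (𝔓.comap ι).under (𝓞 F) := by rw [← h𝔓.2.over, ← hQ.2.over]
  have h2 := hΦ (ι y)
  rw [MulSemiringAction.toAlgHom_apply, h3] at h2
  have h4 : ι (AlgEquiv.restrictNormalHom L (absoluteGaloisGroup.toAlgEquiv F Φ) • y -
      y ^ Nat.card (𝓞 F ⧸ (𝔓.comap ι).under (𝓞 F))) ∈ 𝔓 := by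
    rw [map_sub ι, map_pow ι, h1]
    exact h2
  exact Ideal.mem_comap.mpr h4

end RestrictFrobenius

/-- **The identity is a Frobenius at a prime of residue degree one.** [folklore] -/
theorem isArithFrobAt_one_of_inertiaDeg_eq_one {M E : Type*} [Field M] [NumberField M] [Field E]
    [NumberField E] [Algebra M E] [IsGalois M E] {q : HeightOneSpectrum (𝓞 M)} {Q : Ideal (𝓞 E)}
    (hQ : Q ∈ q.asIdeal.primesOver (𝓞 E)) (hf : Q.inertiaDeg (𝓞 M) = 1) :
    IsArithFrobAt (𝓞 M) (1 : E ≃ₐ[M] E) Q := by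
  classical
  haveI := hQ.1
  haveI := hQ.2
  haveI : q.asIdeal.IsMaximal := q.isMaximal
  have hQne : Q ≠ ⊥ := Ideal.ne_bot_of_mem_primesOver q.ne_bot hQ
  haveI : Q.IsMaximal := hQ.1.isMaximal hQne
  haveI : Finite (𝓞 E ⧸ Q) := Ideal.finiteQuotientOfFreeOfNeBot Q hQne
  letI : Field (𝓞 E ⧸ Q) := Ideal.Quotient.field Q
  letI : Fintype (𝓞 E ⧸ Q) := Fintype.ofFinite _
  have hcard : Nat.card (𝓞 M ⧸ Q.under (𝓞 M)) = Fintype.card (𝓞 E ⧸ Q) := by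
    have h := Ideal.cardQuot_pow_inertiaDeg (R := 𝓞 M) q.asIdeal Q
    rw [hf, pow_one, Submodule.cardQuot_apply, Submodule.cardQuot_apply] at h
    rw [← hQ.2.over, h, Nat.card_eq_fintype_card]
  intro x
  rw [MulSemiringAction.toAlgHom_apply, one_smul, hcard, ← Ideal.Quotient.eq_zero_iff_mem,
    map_sub, map_pow, FiniteField.pow_card, sub_self]

end Literature.NumberTheory.GaloisRepresentations

/-! ### Chebotarev's theorem for normal subgroups, from Frobenius' theorem on split primes -/

namespace Literature.NumberTheory.GaloisRepresentations

open Field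

/-- **Frobenius' theorem for a normal subgroup, over a number field `F`.** Let `φ : Γ_F → G`
be a homomorphism with open kernel and `H ≤ G` a subgroup whose preimage `φ⁻¹(H)` is normal in
`Γ_F`. The set of finite places `v` of `F` at which `φ` is unramified (`φ` kills every inertia
group `I_𝔓`, `𝔓 ∣ v`) and all of whose Frobenius elements map into `H` has strong Dirichlet
density `1/[Γ_F : φ⁻¹(H)]`: off the finitely many places ramified in `L = F̄^{ker φ}` it is the
set of places splitting completely in the Galois extension `E = F̄^{φ⁻¹(H)}` of degree
`[Γ_F : φ⁻¹(H)]` (`hasStrongDirichletDensity_splitPrimes`; Marcus, *Number Fields*, Ch. 7,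
Thm. 43, with the Frobenius dictionary of Ch. 4, Thm. 32 ff.). [cite: Marcus2018, Ch. 7, Thm. 43] -/
theorem hasStrongDirichletDensity_setOf_frobenius_mem {F : Type} [Field F] [NumberField F]
    {G : Type*} [Group G] (φ : absoluteGaloisGroup F →* G)
    (hker : IsOpen ((φ.ker : Subgroup (absoluteGaloisGroup F)) : Set (absoluteGaloisGroup F)))
    (H : Subgroup G) (hn : (H.comap φ).Normal) :
    LFunctions.HasStrongDirichletDensity F
      {v : HeightOneSpectrum (𝓞 F) |
        (∀ 𝔓 ∈ v.primesAbove, ∀ σ ∈ 𝔓.inertia (absoluteGaloisGroup F), φ σ = 1) ∧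
        (∀ 𝔓 ∈ v.primesAbove, ∀ σ : absoluteGaloisGroup F, IsArithFrobAt (𝓞 F) σ 𝔓 → φ σ ∈ H)}
      (1 / (H.comap φ).index) := by
  classical
  -- the finite Galois extensions `L = F̄^{ker φ}` and `E = F̄^{φ⁻¹ H}`
  set N : Subgroup (absoluteGaloisGroup F) := φ.ker with hNdef
  set L : IntermediateField F (AlgebraicClosure F) := IntermediateField.fixedField N with hLdef
  have hLN : L.fixingSubgroup = N := fixingSubgroup_fixedField_of_isOpen N hker
  haveI : FiniteDimensional F L := finiteDimensional_fixedField_of_isOpen N hker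
  haveI : IsGalois F L := by
    rw [← InfiniteGalois.normal_iff_isGalois, hLN, hNdef]
    exact MonoidHom.normal_ker _
  haveI : NumberField L := NumberField.of_module_finite F L
  set N' : Subgroup (absoluteGaloisGroup F) := H.comap φ with hN'def
  have hNN' : N ≤ N' := fun τ hτ => by
    rw [hNdef, MonoidHom.mem_ker] at hτ
    rw [hN'def, Subgroup.mem_comap, hτ]
    exact H.one_mem
  have hN'open : IsOpen ((N' : Subgroup (absoluteGaloisGroup F)) : Set (absoluteGaloisGroup F)) :=
    Subgroup.isOpen_mono hNN' hker
  set E : IntermediateField F (AlgebraicClosure F) := IntermediateField.fixedField N' with hEdef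
  have hEN' : E.fixingSubgroup = N' := fixingSubgroup_fixedField_of_isOpen N' hN'open
  haveI : FiniteDimensional F E := finiteDimensional_fixedField_of_isOpen N' hN'open
  haveI : IsGalois F E := by
    rw [← InfiniteGalois.normal_iff_isGalois, hEN']
    exact hn
  haveI : NumberField E := NumberField.of_module_finite F E
  have hfin : Module.finrank F E = N'.index := finrank_fixedField_of_isOpen N' hN'open
  -- density of the split primes of `E`
  have hsd := hasStrongDirichletDensity_splitPrimes F E
  rw [hfin] at hsd
  -- the finite exceptional set
  set Bad : Set (HeightOneSpectrum (𝓞 F)) :=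
    {q | ¬ Algebra.IsUnramifiedIn (𝓞 L) q.asIdeal} ∪ {q | ¬ Algebra.IsUnramifiedIn (𝓞 E) q.asIdeal}
    with hBad
  have hBadfin : Bad.Finite :=
    (finite_setOf_not_isUnramifiedIn F L).union (finite_setOf_not_isUnramifiedIn F E)
  refine hsd.of_finite_symmDiff hBadfin fun v hvBad => ?_
  -- pointwise comparison at a good place `v`
  simp only [hBad, Set.mem_union, Set.mem_setOf_eq, not_or, not_not] at hvBad
  obtain ⟨hunrL, hunrE⟩ := hvBad
  simp only [Set.mem_setOf_eq]
  constructor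
  · intro hsplit
    refine ⟨fun 𝔓 h𝔓 g hg => ?_, fun 𝔓 h𝔓 Φ hΦ => ?_⟩
    · -- inertia dies in `Gal(L/F)`, so `g ∈ Gal(F̄/L) = ker φ`
      have h1 := restrictHom_mem_inertia L (𝔓 := 𝔓) hg
      rw [inertia_eq_bot_of_isUnramifiedIn hunrL
        (comap_ringOfIntegersToIntegralClosure_mem_primesOver L h𝔓), Subgroup.mem_bot,
        absoluteGaloisGroup.restrictNormalHom_eq_one_iff, hLN, hNdef] at h1
      exact (MonoidHom.mem_ker (f := φ)).mp h1
    · -- the Frobenius of `E` at `𝔓 ∩ 𝓞 E` is trivial, so `Φ ∈ Gal(F̄/E) = φ⁻¹ H`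
      have hQ := comap_ringOfIntegersToIntegralClosure_mem_primesOver E h𝔓
      have hFr := isArithFrobAt_restrictHom E h𝔓 hΦ
      have h1 := isArithFrobAt_one_of_inertiaDeg_eq_one hQ (hsplit.2 _ hQ)
      have heq := eq_of_isArithFrobAt_of_isUnramifiedIn hunrE hQ hFr h1
      rw [absoluteGaloisGroup.restrictNormalHom_eq_one_iff, hEN'] at heq
      exact heq
  · rintro ⟨-, hfrob⟩
    obtain ⟨𝔓, h𝔓⟩ := HeightOneSpectrum.primesAbove_nonempty v
    obtain ⟨Φ, hΦ⟩ := HeightOneSpectrum.exists_isArithFrobAt_of_mem_primesAbove_holds h𝔓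
    have hmem : Φ ∈ (E.fixingSubgroup : Subgroup (absoluteGaloisGroup F)) := by
      rw [hEN']
      exact hfrob 𝔓 h𝔓 Φ hΦ
    have hone : AlgEquiv.restrictNormalHom E (absoluteGaloisGroup.toAlgEquiv F Φ) = 1 :=
      (absoluteGaloisGroup.restrictNormalHom_eq_one_iff E Φ).mpr hmem
    have hQ := comap_ringOfIntegersToIntegralClosure_mem_primesOver E h𝔓
    have hFr := isArithFrobAt_restrictHom E h𝔓 hΦ
    rw [hone] at hFr
    -- `f(𝔓 ∩ 𝓞 E | v) = 1`
    set Q := Ideal.comap (EllipticCurves.ringOfIntegersToIntegralClosure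
      (k := F) (Ω := AlgebraicClosure F) E) 𝔓 with hQdef
    haveI := hQ.1
    haveI := hQ.2
    haveI : v.asIdeal.IsMaximal := v.isMaximal
    have hQne : Q ≠ ⊥ := Ideal.ne_bot_of_mem_primesOver v.ne_bot hQ
    haveI : Q.IsMaximal := hQ.1.isMaximal hQne
    haveI : Module.Finite (𝓞 F) (𝓞 E) := IsIntegralClosure.finite (𝓞 F) F E (𝓞 E)
    haveI : Finite (𝓞 F ⧸ v.asIdeal) := Ideal.finiteQuotientOfFreeOfNeBot _ v.ne_bot
    have hq1 : 1 < Nat.card (𝓞 F ⧸ v.asIdeal) := by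
      rw [← Submodule.cardQuot_apply, ← Ideal.absNorm_apply]
      exact NumberField.HeightOneSpectrum.one_lt_absNorm v
    have hf : Q.inertiaDeg (𝓞 F) = 1 := by
      refine inertiaDeg_eq_one_of_forall_pow_sub_mem' v.asIdeal Q hq1 fun y => ?_
      have h1 := hFr y
      rw [MulSemiringAction.toAlgHom_apply, one_smul, ← hQ.2.over] at h1
      rw [← Ideal.neg_mem_iff, neg_sub]
      exact h1
    exact mem_splitPrimes_of_inertiaDeg_eq_one hunrE hQ hf

end Literature.NumberTheory.GaloisRepresentations

namespace Literature.NumberTheory.LFunctions.Chebotarev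

open Field Literature.NumberTheory.GaloisRepresentations

/-- **Chebotarev's density theorem over `ℚ` for a normal subgroup**, the part of Neukirch VII
(13.4) that follows from Frobenius' theorem (the pole of Dedekind zeta functions) alone: for
`φ : Γ_ℚ → G` with open kernel and `H ≤ G` with `φ⁻¹(H)` normal in `Γ_ℚ` (e.g. `H` normal, or
`G` abelian), the set `frobPrimes φ H` of primes `p` unramified for `φ` whose Frobenius elements
map into `H` has Dirichlet density `1/[Γ_ℚ : φ⁻¹(H)]` (`= |H|/|G|` for `φ` onto a finite `G`).
[cite: Marcus2018, Ch. 7, Thm. 43] -/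
theorem hasDirichletDensity_frobPrimes_of_normal {G : Type*} [Group G]
    (φ : absoluteGaloisGroup ℚ →* G)
    (hker : IsOpen ((φ.ker : Subgroup (absoluteGaloisGroup ℚ)) : Set (absoluteGaloisGroup ℚ)))
    (H : Subgroup G) (hn : (H.comap φ).Normal) :
    HasDirichletDensity (frobPrimes φ H) (1 / (H.comap φ).index) := by
  have h := (hasStrongDirichletDensity_setOf_frobenius_mem φ hker H hn).hasDirichletDensity_rat
  refine (hasDirichletDensity_congr fun p hp => ?_).mp h
  set v : HeightOneSpectrum (𝓞 ℚ) := primesEquiv.symm ⟨p, hp⟩ with hvdef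
  have hvp : ((primesEquiv v : Nat.Primes) : ℕ) = p := by rw [hvdef, Equiv.apply_symm_apply]
  conv_rhs => rw [← hvp, primesEquiv_mem_frobPrimes_iff]
  exact ⟨fun ⟨_, h⟩ => h, fun h => ⟨hp, h⟩⟩

/-- The same for `φ` onto a finite group `G` and a normal subgroup `H`: `frobPrimes φ H` has
Dirichlet density `|H| / |G|`. [cite: Marcus2018, Ch. 7, Thm. 43] -/
theorem hasDirichletDensity_frobPrimes_subgroup {G : Type*} [Group G] [Finite G]
    (φ : absoluteGaloisGroup ℚ →* G)
    (hker : IsOpen ((φ.ker : Subgroup (absoluteGaloisGroup ℚ)) : Set (absoluteGaloisGroup ℚ)))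
    (hsurj : Function.Surjective φ) (H : Subgroup G) [hn : H.Normal] :
    HasDirichletDensity (frobPrimes φ H) ((Nat.card H : ℝ) / Nat.card G) := by
  haveI : (H.comap φ).Normal := Subgroup.normal_comap φ
  have h := hasDirichletDensity_frobPrimes_of_normal φ hker H inferInstance
  rw [Subgroup.index_comap_of_surjective H hsurj] at h
  have hH : (Nat.card H : ℝ) ≠ 0 := Nat.cast_ne_zero.mpr Nat.card_pos.ne'
  have hidx : (Nat.card H : ℝ) * H.index = Nat.card G := by exact_mod_cast H.card_mul_index
  convert h using 1
  rw [← hidx]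
  field_simp

end Literature.NumberTheory.LFunctions.Chebotarev

namespace Literature.NumberTheory.EllipticCurves.ModularForms.DeligneSerre1974

open Finset

/-! ### Cyclotomic embeddings -/

section Cyclotomic

open Polynomial IntermediateField

/-- **Conjugation of roots of unity by a unit exponent.** For `n ≥ 1` and `u ∈ (ℤ/nℤ)ˣ` there
are a subfield `K ⊆ ℂ` containing all `n`-th roots of unity (namely `ℚ(ζ_n)`) and an embedding
`τ : K → ℂ` with `τ(ω) = ω^u` for every `n`-th root of unity `ω` (the automorphism
`ζ_n ↦ ζ_n^u` of the cyclotomic field; `cyclotomic n ℚ` is the minimal polynomial of `ζ_n`,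
Mathlib `Polynomial.cyclotomic_eq_minpoly_rat`). [folklore] -/
theorem exists_ringHom_apply_rootOfUnity_eq_pow (n : ℕ) [NeZero n] (u : (ZMod n)ˣ) :
    ∃ (K : IntermediateField ℚ ℂ) (hK : ∀ ω : ℂ, ω ^ n = 1 → ω ∈ K) (τ : K →+* ℂ),
      ∀ (ω : ℂ) (hω : ω ^ n = 1), τ ⟨ω, hK ω hω⟩ = ω ^ (u : ZMod n).val := by
  set ζ : ℂ := Complex.exp (2 * Real.pi * Complex.I / n) with hζdef
  have hζ : IsPrimitiveRoot ζ n := Complex.isPrimitiveRoot_exp n (NeZero.ne n)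
  have hint : IsIntegral ℚ ζ := (hζ.isIntegral (NeZero.pos n)).tower_top
  set K : IntermediateField ℚ ℂ := ℚ⟮ζ⟯ with hKdef
  have hζK : ζ ∈ K := mem_adjoin_simple_self ℚ ζ
  have hK : ∀ ω : ℂ, ω ^ n = 1 → ω ∈ K := fun ω hω => by
    obtain ⟨i, -, rfl⟩ := hζ.eq_pow_of_pow_eq_one hω
    exact pow_mem hζK i
  have hroot : ζ ^ (u : ZMod n).val ∈ (minpoly ℚ ζ).aroots ℂ := by
    have hu : IsPrimitiveRoot (ζ ^ (u : ZMod n).val) n :=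
      hζ.pow_of_coprime _ (ZMod.val_coe_unit_coprime u)
    rw [mem_aroots, ← cyclotomic_eq_minpoly_rat hζ (NeZero.pos n)]
    refine ⟨cyclotomic_ne_zero n ℚ, ?_⟩
    rw [aeval_def, ← eval_map, map_cyclotomic]
    exact (isRoot_cyclotomic_iff.mpr hu).eq_zero
  set τa : K →ₐ[ℚ] ℂ := (algHomAdjoinIntegralEquiv ℚ hint).symm ⟨_, hroot⟩ with hτa
  have hτζ : τa ⟨ζ, hζK⟩ = ζ ^ (u : ZMod n).val :=
    algHomAdjoinIntegralEquiv_symm_apply_gen ℚ hint ⟨_, hroot⟩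
  refine ⟨K, hK, τa.toRingHom, fun ω hω => ?_⟩
  obtain ⟨i, -, rfl⟩ := hζ.eq_pow_of_pow_eq_one hω
  have h1 : (⟨ζ ^ i, hK _ hω⟩ : K) = ⟨ζ, hζK⟩ ^ i := Subtype.ext rfl
  rw [AlgHom.toRingHom_eq_coe, RingHom.coe_coe, h1, map_pow, hτζ, ← pow_mul, ← pow_mul, mul_comm]

end Cyclotomic

/-! ### A Möbius identity for sums over unit exponents -/

section Moebius

open ArithmeticFunction Literature.NumberTheory.GaloisRepresentations

/-- **`Σ_{u ∈ (ℤ/nℤ)ˣ} ω^u` by Möbius inversion**: for `ω^n = 1`,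
`Σ_{u ∈ (ℤ/nℤ)ˣ} ω^u = Σ_{e ∣ n} μ(e) · (n/e) · [ω^e = 1]`
(`1_{(j,n)=1} = Σ_{e ∣ (j,n)} μ(e)` and the geometric sums `Σ_{i < n/e} ω^{ei}`). [folklore] -/
theorem sum_units_pow_eq_sum_divisors_moebius {n : ℕ} [NeZero n] {ω : ℂ} (hω : ω ^ n = 1) :
    ∑ u : (ZMod n)ˣ, ω ^ (u : ZMod n).val =
      ∑ e ∈ n.divisors, (ArithmeticFunction.moebius e : ℂ) * (if ω ^ e = 1 then ((n / e : ℕ) : ℂ) else 0) := by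
  classical
  have hn : 0 < n := NeZero.pos n
  -- Step 1: as a sum over `ZMod n` with the indicator of coprimality
  have h1 : ∑ u : (ZMod n)ˣ, ω ^ (u : ZMod n).val =
      ∑ x : ZMod n, if x.val.Coprime n then ω ^ x.val else 0 := by
    rw [← Finset.sum_filter]
    refine Finset.sum_bij (fun u _ => (u : ZMod n)) (fun u _ => ?_) (fun u _ v _ h => Units.ext h)
      (fun x hx => ?_) (fun u _ => rfl)
    · exact Finset.mem_filter.mpr ⟨Finset.mem_univ _, ZMod.val_coe_unit_coprime u⟩
    · rw [Finset.mem_filter] at hx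
      exact ⟨ZMod.unitOfCoprime x.val hx.2, Finset.mem_univ _, by simp⟩
  -- Step 2: as a sum over `j < n`
  have h2 : ∑ x : ZMod n, (if x.val.Coprime n then ω ^ x.val else 0) =
      ∑ j ∈ range n, if j.Coprime n then ω ^ j else 0 := by
    have himg : (univ : Finset (ZMod n)).image ZMod.val = range n := by
      ext j
      simp only [mem_image, mem_univ, true_and, mem_range]
      constructor
      · rintro ⟨x, rfl⟩
        exact ZMod.val_lt x
      · intro hj
        exact ⟨(j : ZMod n), ZMod.val_cast_of_lt hj⟩
    rw [← himg, Finset.sum_image fun x _ y _ h => ZMod.val_injective n h]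
  -- Step 3: the indicator of coprimality through Möbius
  have h3 : ∀ j : ℕ, (if j.Coprime n then ω ^ j else (0 : ℂ)) =
      ∑ e ∈ n.divisors, (ArithmeticFunction.moebius e : ℂ) * (if e ∣ j then ω ^ j else 0) := by
    intro j
    have key := sum_divisors_intCast_moebius_eq_ite (j.gcd n)
    have hfilter : n.divisors.filter (fun e => e ∣ j) = (j.gcd n).divisors := by
      ext e
      simp only [mem_filter, Nat.mem_divisors]
      constructor
      · rintro ⟨⟨hen, hn0⟩, hej⟩
        exact ⟨Nat.dvd_gcd hej hen, (Nat.gcd_pos_of_pos_right j hn).ne'⟩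
      · rintro ⟨he, -⟩
        exact ⟨⟨(Nat.dvd_gcd_iff.mp he).2, hn.ne'⟩, (Nat.dvd_gcd_iff.mp he).1⟩
    have hcast : (∑ e ∈ (j.gcd n).divisors, (ArithmeticFunction.moebius e : ℂ)) = if j.gcd n = 1 then 1 else 0 := by
      have := congrArg (Int.cast : ℤ → ℂ) key
      push_cast at this
      rw [this]
    calc (if j.Coprime n then ω ^ j else (0 : ℂ))
        = (∑ e ∈ (j.gcd n).divisors, (ArithmeticFunction.moebius e : ℂ)) * ω ^ j := by
          rw [hcast]
          by_cases hj : j.Coprime n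
          · rw [if_pos hj, if_pos (Nat.coprime_iff_gcd_eq_one.mp hj), one_mul]
          · rw [if_neg hj, if_neg (fun h => hj (Nat.coprime_iff_gcd_eq_one.mpr h)), zero_mul]
      _ = ∑ e ∈ n.divisors, (ArithmeticFunction.moebius e : ℂ) * (if e ∣ j then ω ^ j else 0) := by
          rw [← hfilter, Finset.sum_filter, Finset.sum_mul]
          refine Finset.sum_congr rfl fun e _ => ?_
          split_ifs <;> simp
  -- Step 4: swap and evaluate the geometric sums
  rw [h1, h2, Finset.sum_congr rfl (fun j _ => h3 j), Finset.sum_comm]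
  refine Finset.sum_congr rfl fun e he => ?_
  rw [← Finset.mul_sum]
  congr 1
  have he0 : 0 < e := Nat.pos_of_mem_divisors he
  obtain ⟨k, hk⟩ := Nat.dvd_of_mem_divisors he
  have hk' : n / e = k := by rw [hk, Nat.mul_div_cancel_left _ he0]
  have h4 : ∑ j ∈ range n, (if e ∣ j then ω ^ j else (0 : ℂ)) = ∑ i ∈ range k, (ω ^ e) ^ i := by
    rw [hk, ← Finset.sum_filter]
    have himg : (range (e * k)).filter (fun j => e ∣ j) = (range k).image (fun i => e * i) := by
      ext j
      simp only [mem_filter, mem_range, mem_image]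
      constructor
      · rintro ⟨hj, i, rfl⟩
        exact ⟨i, Nat.lt_of_mul_lt_mul_left hj, rfl⟩
      · rintro ⟨i, hi, rfl⟩
        exact ⟨Nat.mul_lt_mul_of_pos_left hi he0, i, rfl⟩
    rw [himg, Finset.sum_image fun i _ j _ h => Nat.eq_of_mul_eq_mul_left he0 h]
    exact Finset.sum_congr rfl fun i _ => by rw [pow_mul]
  rw [h4, hk']
  by_cases h : ω ^ e = 1
  · rw [if_pos h, h]
    simp
  · rw [if_neg h, geom_sum_eq h, ← pow_mul, ← hk, hω, sub_self, zero_div]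

/-- Raising to a power prime to `n` permutes a finite subgroup of `ℂˣ` killed by `n`, so it does
not change the sum of its elements. [folklore] -/
theorem sum_coe_pow_eq_sum_coe {n : ℕ} {G : Subgroup ℂˣ} [Fintype G]
    (hG : ∀ ω : G, ((ω : ℂˣ) : ℂ) ^ n = 1) {k : ℕ} (hk : k.Coprime n) :
    ∑ ω : G, ((ω : ℂˣ) : ℂ) ^ k = ∑ ω : G, ((ω : ℂˣ) : ℂ) := by
  have hinj : Function.Injective (fun ω : G => ω ^ k) := by
    intro a b hab
    have h1 : (a * b⁻¹) ^ k = 1 := by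
      have : a ^ k = b ^ k := hab
      rw [mul_pow, inv_pow, this, mul_inv_cancel]
    have h2 : (a * b⁻¹) ^ n = 1 := by
      apply Subtype.ext
      apply Units.ext
      rw [SubgroupClass.coe_pow, Units.val_pow_eq_pow_val]
      exact hG _
    have h3 : (a * b⁻¹) ^ k.gcd n = 1 := pow_gcd_eq_one.mpr ⟨h1, h2⟩
    rw [Nat.Coprime.gcd_eq_one hk, pow_one, mul_inv_eq_one] at h3
    exact h3
  have hbij : Function.Bijective (fun ω : G => ω ^ k) := (Finite.injective_iff_bijective).mp hinj
  rw [← Function.Bijective.sum_comp hbij (fun ω : G => ((ω : ℂˣ) : ℂ))]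
  refine Finset.sum_congr rfl fun ω _ => ?_
  simp only [SubgroupClass.coe_pow, Units.val_pow_eq_pow_val]

open Classical in
/-- **The Möbius weights are orthogonal to the subgroup counts.** For a non-trivial finite
subgroup `G ⊆ ℂˣ` killed by `n ≥ 1`:
`Σ_{e ∣ n} μ(e) · (n/e) · #{ω ∈ G : ω^e = 1} = Σ_{ω ∈ G} Σ_{u ∈ (ℤ/nℤ)ˣ} ω^u = Σ_u Σ_ω ω = 0`.
[folklore] -/
theorem sum_divisors_moebius_mul_card_eq_zero {n : ℕ} [NeZero n] {G : Subgroup ℂˣ} [Fintype G]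
    (hG : ∀ ω : G, ((ω : ℂˣ) : ℂ) ^ n = 1) {g₀ : G} (hg₀ : g₀ ≠ 1) :
    ∑ e ∈ n.divisors, (ArithmeticFunction.moebius e : ℝ) * ((n / e : ℕ) : ℝ) *
      (Finset.univ.filter fun ω : G => ((ω : ℂˣ) : ℂ) ^ e = 1).card = 0 := by
  -- work in `ℂ`
  have key : ∑ e ∈ n.divisors, (ArithmeticFunction.moebius e : ℂ) *
      (∑ ω : G, if ((ω : ℂˣ) : ℂ) ^ e = 1 then ((n / e : ℕ) : ℂ) else 0) = 0 := by
    calc ∑ e ∈ n.divisors, (ArithmeticFunction.moebius e : ℂ) *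
          (∑ ω : G, if ((ω : ℂˣ) : ℂ) ^ e = 1 then ((n / e : ℕ) : ℂ) else 0)
        = ∑ ω : G, ∑ e ∈ n.divisors, (ArithmeticFunction.moebius e : ℂ) *
            (if ((ω : ℂˣ) : ℂ) ^ e = 1 then ((n / e : ℕ) : ℂ) else 0) := by
          rw [Finset.sum_comm]
          exact Finset.sum_congr rfl fun e _ => by rw [Finset.mul_sum]
      _ = ∑ ω : G, ∑ u : (ZMod n)ˣ, ((ω : ℂˣ) : ℂ) ^ (u : ZMod n).val :=
          Finset.sum_congr rfl fun ω _ => (sum_units_pow_eq_sum_divisors_moebius (hG ω)).symm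
      _ = ∑ u : (ZMod n)ˣ, ∑ ω : G, ((ω : ℂˣ) : ℂ) := by
          rw [Finset.sum_comm]
          exact Finset.sum_congr rfl fun u _ => sum_coe_pow_eq_sum_coe hG (ZMod.val_coe_unit_coprime u)
      _ = 0 := by
          rw [sum_coe_eq_zero_of_ne_one hg₀, Finset.sum_const_zero]
  have hcount : ∀ e : ℕ, (∑ ω : G, if ((ω : ℂˣ) : ℂ) ^ e = 1 then ((n / e : ℕ) : ℂ) else 0) =
      ((n / e : ℕ) : ℂ) * ((Finset.univ.filter fun ω : G => ((ω : ℂˣ) : ℂ) ^ e = 1).card : ℂ) := by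
    intro e
    rw [← Finset.sum_filter, Finset.sum_const, nsmul_eq_mul, mul_comm]
  simp_rw [hcount, ← mul_assoc] at key
  have : ((∑ e ∈ n.divisors, (ArithmeticFunction.moebius e : ℝ) * ((n / e : ℕ) : ℝ) *
      ((Finset.univ.filter fun ω : G => ((ω : ℂˣ) : ℂ) ^ e = 1).card : ℝ) : ℝ) : ℂ) = 0 := by
    push_cast
    exact key
  exact_mod_cast this

end Moebius

/-! ### The abstract contradiction -/

section Endgame

open Classical in
/-- **The contradiction of Deligne–Serre 1974, 8.7, averaged over conjugates.** Suppose that for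
`s > 1` the terms `T(s, p)` decompose as
`2J·𝟙_U(p) p^{-s} + 2 ∑_{i ∈ S} w_i 𝟙_{X_i}(p) p^{-s}` where `U` has Dirichlet density `1`,
`X_i` has Dirichlet density `d_i` and `∑_i w_i d_i = 0`. Then `∑_p T(s, p) / log (1/(s-1)) → 2J`,
so for `J > 0` the bound `∑_p T(s, p) ≤ J log (1/(s-1)) + O(1)` is impossible.
[cite: DeligneSerreASENS1974, §8.7] -/
theorem false_of_rankin_bound_sum {T : ℝ → ℕ → ℝ} {ι : Type*} (S : Finset ι) (w : ι → ℝ)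
    (X : ι → Set ℕ) (d : ι → ℝ) (hX : ∀ i ∈ S, LFunctions.HasDirichletDensity (X i) (d i))
    (hw : ∑ i ∈ S, w i * d i = 0) (U : Set ℕ) (hU : LFunctions.HasDirichletDensity U 1)
    {J : ℝ} (hJ : 0 < J)
    (hT : ∀ s : ℝ, 1 < s → ∀ p : ℕ, T s p =
      2 * J * (if p.Prime ∧ p ∈ U then (p : ℝ) ^ (-s) else 0) +
        2 * ∑ i ∈ S, w i * (if p.Prime ∧ p ∈ X i then (p : ℝ) ^ (-s) else 0))
    (C : ℝ) (hbound : ∀ᶠ s : ℝ in 𝓝[>] (1 : ℝ),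
      ∑' p, T s p ≤ J * Real.log (1 / (s - 1)) + C) :
    False := by
  have hX' : ∀ i ∈ S, Tendsto (fun s : ℝ ↦ (∑' p : ℕ, (if p.Prime ∧ p ∈ X i then (p : ℝ) ^ (-s)
      else 0)) / Real.log (1 / (s - 1))) (𝓝[>] (1 : ℝ)) (𝓝 (d i)) := fun i hi ↦ hX i hi
  have hU' : Tendsto (fun s : ℝ ↦ (∑' p : ℕ, (if p.Prime ∧ p ∈ U then (p : ℝ) ^ (-s)
      else 0)) / Real.log (1 / (s - 1))) (𝓝[>] (1 : ℝ)) (𝓝 1) := hU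
  -- the prime sum of `T`
  have hsum : ∀ s : ℝ, 1 < s → ∑' p, T s p =
      2 * J * (∑' p : ℕ, (if p.Prime ∧ p ∈ U then (p : ℝ) ^ (-s) else 0)) +
        2 * ∑ i ∈ S, w i * (∑' p : ℕ, (if p.Prime ∧ p ∈ X i then (p : ℝ) ^ (-s) else 0)) := by
    intro s hs
    have h1 : Summable (fun p : ℕ ↦ if p.Prime ∧ p ∈ U then (p : ℝ) ^ (-s) else 0) :=
      LFunctions.PrimeSum.summable U hs
    have h2 : ∀ i ∈ S, Summable (fun p : ℕ ↦
        w i * (if p.Prime ∧ p ∈ X i then (p : ℝ) ^ (-s) else 0)) :=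
      fun i _ ↦ (LFunctions.PrimeSum.summable (X i) hs).mul_left (w i)
    have h3 : Summable (fun p : ℕ ↦
        ∑ i ∈ S, w i * (if p.Prime ∧ p ∈ X i then (p : ℝ) ^ (-s) else 0)) :=
      summable_sum fun i hi ↦ h2 i hi
    rw [tsum_congr (hT s hs), (h1.mul_left (2 * J)).tsum_add (h3.mul_left 2), tsum_mul_left,
      tsum_mul_left, Summable.tsum_finsetSum (fun i hi ↦ h2 i hi)]
    simp only [tsum_mul_left]
  -- its asymptotic: `→ 2J`
  have hlim : Tendsto (fun s : ℝ ↦ (∑' p, T s p) / Real.log (1 / (s - 1))) (𝓝[>] (1 : ℝ))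
      (𝓝 (2 * J)) := by
    have e := (hU'.const_mul (2 * J)).add
      ((tendsto_finsetSum S fun i hi ↦ (hX' i hi).const_mul (w i)).const_mul 2)
    have h2 : (2 * J) * 1 + 2 * ∑ i ∈ S, w i * d i = 2 * J := by rw [hw]; ring
    rw [h2] at e
    refine e.congr' ?_
    filter_upwards [LFunctions.PrimeSum.eventually_one_lt] with s hs
    rw [hsum s hs]
    simp only [add_div, mul_div_assoc, Finset.sum_div]
  -- the bound: `≤ J + C / log`, whose limit is `J`
  have hlim1 : Tendsto (fun s : ℝ ↦ J + C / Real.log (1 / (s - 1))) (𝓝[>] (1 : ℝ)) (𝓝 J) := by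
    have := (tendsto_const_nhds (x := C)).div_atTop LFunctions.PrimeSum.tendsto_log_one_div_sub_one
    simpa using this.const_add J
  have hle : ∀ᶠ s : ℝ in 𝓝[>] (1 : ℝ),
      (∑' p, T s p) / Real.log (1 / (s - 1)) ≤ J + C / Real.log (1 / (s - 1)) := by
    filter_upwards [hbound, LFunctions.PrimeSum.eventually_log_pos] with s hb hlog
    rw [div_le_iff₀ hlog, add_mul, div_mul_cancel₀ _ hlog.ne']
    exact hb
  have := le_of_tendsto_of_tendsto hlim hlim1 hle
  linarith

end Endgame


/-! ### Thm. 4.1 (irreducibility), from Prop. 2.7 (2.7.4), Prop. 5.1 and Frobenius' theorem -/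

section Irreducible

open scoped MatrixGroups NumberField
open CongruenceSubgroup Field Polynomial IsDedekindDomain Rat.HeightOneSpectrum
  Literature.NumberTheory.GaloisRepresentations

variable {N : ℕ} [NeZero N]

open Classical in
/-- **Deligne–Serre 1974, Thm. 4.1 (irreducibility), without the Chebotarev density theorem.**
For a newform `f ∈ S_1(Γ₁(N))`, every finite-image representation `ρ : Gal(ℚ̄/ℚ) → GL₂(ℂ)`
attached to `f` away from `N` is irreducible, granted op. cit. (2.7.4) (`prop27_conj`:
conjugates of eigenforms are eigenforms) and the newform facts `f ∈ S_1(N, ε)`, `T_p f = a_p f`.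
Printed proof (op. cit. 8.7): if `ρ = χ₁ ⊕ χ₂` then `a_p = χ₁(F_p) + χ₂(F_p)` and
`∑ |a_p|² p^{-s} ∼ 2 log (1/(s-1))` contradicts Prop. 5.1; there the asymptotic comes from
`∑_p χ₁χ₂⁻¹(F_p) p^{-s} = O(1)` (class field theory and Dirichlet). Here instead Prop. 5.1 is
applied to all the conjugate eigenforms `σ_u(f)` (`T_p σ_u(f) = (χ₁(F_p)^u + χ₂(F_p)^u) σ_u(f)`,
`u ∈ (ℤ/nℤ)ˣ`, `n = |ρ(Γ_ℚ)|`, by (2.7.4) as in the printed proof of Prop. 5.5) and summed over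
`u`: by Möbius inversion `∑_u |1 + ψ(F_p)^u|² = 2φ(n) + 2 ∑_{e∣n} μ(e)(n/e)·[ψ(F_p)^e = 1]`,
`ψ = χ₁χ₂⁻¹`, and the sets `{p : ψ(F_p)^e = 1}` have Dirichlet densities `#ψ(Γ)[e]/#ψ(Γ)` by
Frobenius' theorem (split primes of `ℚ̄^{ker ψ^e}`, `hasDirichletDensity_frobPrimes_subgroup`),
whose Möbius combination vanishes as `ψ ≠ 1`; so `∑_u ∑_p |a_p(σ_u f)|² p^{-s} ∼ 2φ(n) log (1/(s-1))`,
contradicting the sum of the `φ(n)` bounds (5.1.1). (If `ψ = 1` then `|a_p|² = 4` and `f`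
itself contradicts (5.1.1).) [cite: DeligneSerreASENS1974, Thm. 4.1, §8.7 and Prop. 2.7 (2.7.4)] -/
theorem thm41_isIrreducible_of_prop27_conj (h274 : prop27_conj)
    (hneb : IsNewform1.mem_nebentypusSubspace_nebentypus (N := N) (k := 1))
    (heig : IsNewform1.heckeEigenvalue_eq_coeff (N := N) (k := 1)) :
    thm41_isIrreducible (N := N) := by
  intro f hf ρ hρ hfin
  by_contra hirr
  obtain ⟨χ₁, χ₂, htr, hker, hord, -⟩ := exists_characters_of_not_isIrreducible ρ hfin hirr
  haveI : Finite (ρ : absoluteGaloisGroup ℚ →* GL (Fin 2) ℂ).range :=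
    Set.Finite.to_subtype (s := ((ρ : absoluteGaloisGroup ℚ →* GL (Fin 2) ℂ).range :
      Set (GL (Fin 2) ℂ))) (by rw [MonoidHom.coe_range]; exact hfin)
  haveI : Inhabited (absoluteGaloisGroup ℚ) := ⟨1⟩
  set n := Nat.card (ρ : absoluteGaloisGroup ℚ →* GL (Fin 2) ℂ).range with hndef
  have hn : n ≠ 0 := Nat.card_pos.ne'
  haveI : NeZero n := ⟨hn⟩
  have hnorm₁ : ∀ g, ‖χ₁ g‖ = 1 := fun g ↦ Complex.norm_eq_one_of_pow_eq_one (hord g).1 hn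
  have hnorm₂ : ∀ g, ‖χ₂ g‖ = 1 := fun g ↦ Complex.norm_eq_one_of_pow_eq_one (hord g).2 hn
  have hne₂ : ∀ g, χ₂ g ≠ 0 := fun g ↦ by rw [← norm_ne_zero_iff, hnorm₂]; exact one_ne_zero
  -- `ψ = χ₁ χ₂⁻¹`, killed by `n`
  set ψ : absoluteGaloisGroup ℚ →* ℂˣ := χ₁.toHomUnits * (χ₂.toHomUnits)⁻¹ with hψdef
  have hψ : ∀ g, (ψ g : ℂ) = χ₁ g * (χ₂ g)⁻¹ := fun g ↦ by
    simp [hψdef]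
  have hψker : ∀ g, ρ g = 1 → ψ g = 1 := fun g hg ↦ by
    ext; rw [hψ, (hker g hg).1, (hker g hg).2]; simp
  have hψpow : ∀ g (k : ℕ), (ψ g : ℂ) ^ k = χ₁ g ^ k * (χ₂ g ^ k)⁻¹ := fun g k ↦ by
    rw [hψ, mul_pow, inv_pow]
  have hψn : ∀ g, (ψ g : ℂ) ^ n = 1 := fun g ↦ by
    rw [hψpow, (hord g).1, (hord g).2, inv_one, mul_one]
  have hf0 : f ≠ 0 := ne_zero_of_isNormalized hf.2.2.2
  have heigen : ∀ p : ℕ, (hp : p.Prime) → ¬ p ∣ N →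
      ∃ a : ℂ, (haveI : NeZero p := ⟨hp.ne_zero⟩; heckeT (Gamma1 N) 1 p f) = a • f :=
    fun p hp _ ↦ hf.2.1 p hp
  -- (1) Frobenii: a choice `σ p` at each prime `p`
  have hvp : ∀ (p : ℕ) (hp : p.Prime),
      ((primesEquiv (primesEquiv.symm ⟨p, hp⟩ : HeightOneSpectrum (𝓞 ℚ)) : Nat.Primes) : ℕ)
        = p := fun p hp ↦ by simp
  choose 𝔓 h𝔓 using fun (p : ℕ) (hp : p.Prime) ↦
    HeightOneSpectrum.primesAbove_nonempty (primesEquiv.symm ⟨p, hp⟩ : HeightOneSpectrum (𝓞 ℚ))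
  choose σ hσ using fun (p : ℕ) (hp : p.Prime) ↦
    HeightOneSpectrum.exists_isArithFrobAt_of_mem_primesAbove_holds (h𝔓 p hp)
  -- `ψ` is unramified at `p ∤ N` and constant on the Frobenii there
  have hunr : ∀ (p : ℕ) (hp : p.Prime), ¬ p ∣ N →
      ∀ Q ∈ (primesEquiv.symm ⟨p, hp⟩ : HeightOneSpectrum (𝓞 ℚ)).primesAbove,
        ∀ τ ∈ Q.inertia (absoluteGaloisGroup ℚ), ψ τ = 1 := by
    intro p hp hpN Q hQ τ hτ
    have hv : ((primesEquiv (primesEquiv.symm ⟨p, hp⟩ : HeightOneSpectrum (𝓞 ℚ)) :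
        Nat.Primes) : ℕ) ∉ {q | q ∣ N} := by rw [hvp]; exact hpN
    exact hψker τ ((hρ _ hv).1 Q hQ τ hτ)
  have hconst : ∀ (p : ℕ) (hp : p.Prime), ¬ p ∣ N →
      ∀ Q ∈ (primesEquiv.symm ⟨p, hp⟩ : HeightOneSpectrum (𝓞 ℚ)).primesAbove,
        ∀ τ : absoluteGaloisGroup ℚ, IsArithFrobAt (𝓞 ℚ) τ Q → ψ τ = ψ (σ p hp) := by
    intro p hp hpN Q hQ τ hτ
    obtain ⟨γ, -, hγ⟩ := HeightOneSpectrum.exists_isArithFrobAt_conj_of_mem_primesAbove_holds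
      (h𝔓 p hp) hQ (hσ p hp)
    have hin := hτ.mul_inv_mem_inertia hγ
    have h1 := hunr p hp hpN Q hQ _ hin
    rw [map_mul, map_inv, mul_inv_eq_one] at h1
    rw [h1, map_mul, map_mul, map_inv, mul_comm (ψ γ) _, mul_inv_cancel_right]
  -- (2) `a_p = χ₁(F_p) + χ₂(F_p)` for `p ∤ N`
  have hap : ∀ (p : ℕ) (hp : p.Prime), ¬ p ∣ N →
      heckeEigenvalue f p = χ₁ (σ p hp) + χ₂ (σ p hp) := by
    intro p hp hpN
    have hv : ((primesEquiv (primesEquiv.symm ⟨p, hp⟩ : HeightOneSpectrum (𝓞 ℚ)) :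
        Nat.Primes) : ℕ) ∉ {q | q ∣ N} := by rw [hvp]; exact hpN
    have hch := (hρ _ hv).2 _ (h𝔓 p hp) _ (hσ p hp)
    rw [hvp] at hch
    simp only [GaloisRepresentations.FramedRep.charpoly, map_heckePolynomial] at hch
    have htr' := trace_eq_of_charpoly_eq hch
    rw [htr, ← heig hf hp] at htr'
    exact htr'.symm
  -- (3) the case `ψ = 1`: `|a_p|² = 4`, and `f` itself contradicts (5.1.1)
  by_cases htriv : ∀ g, ψ g = 1
  · have hap4 : ∀ (p : ℕ) (hp : p.Prime), ¬ p ∣ N → ‖heckeEigenvalue f p‖ ^ 2 = 4 := by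
      intro p hp hpN
      have heq : χ₁ (σ p hp) = χ₂ (σ p hp) := by
        have := congrArg Units.val (htriv (σ p hp))
        rw [hψ, Units.val_one, mul_inv_eq_one₀ (hne₂ _)] at this
        exact this
      rw [hap p hp hpN, heq, ← two_mul, norm_mul, Complex.norm_two, hnorm₂]
      norm_num
    obtain ⟨-, C, hC⟩ := prop51_holds (nebentypus f) f (hneb hf) hf0 heigen
    simp only [Int.cast_one] at hC
    refine false_of_rankin_bound_sum (T := rankinTerm f) (∅ : Finset ℕ) (fun _ ↦ 0)
      (fun _ ↦ ∅) (fun _ ↦ 0) (fun i hi ↦ absurd hi (Finset.notMem_empty i)) (by simp)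
      {p | ¬ p ∣ N} (hasDirichletDensity_not_dvd (NeZero.ne N)) (J := 2) two_pos ?_ C ?_
    · intro s hs p
      simp only [Finset.sum_empty, mul_zero, add_zero, Set.mem_setOf_eq]
      by_cases hp : p.Prime ∧ ¬ p ∣ N
      · rw [show rankinTerm f s p = ‖heckeEigenvalue f p‖ ^ 2 * (p : ℝ) ^ (-s) by
          simp [rankinTerm, hp.1, hp.2], hap4 p hp.1 hp.2, if_pos hp]
        ring
      · rw [show rankinTerm f s p = 0 by simp only [rankinTerm, hp, if_false], if_neg hp]
        ring
    · filter_upwards [hC, LFunctions.PrimeSum.eventually_log_pos] with s hs hlog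
      linarith
  simp only [not_forall] at htriv
  obtain ⟨σ₁, hσ₁⟩ := htriv
  -- (4) the conjugate eigenforms `σ_u(f)`, `u ∈ (ℤ/nℤ)ˣ`
  choose K hK τ hτ using fun u : (ZMod n)ˣ ↦ exists_ringHom_apply_rootOfUnity_eq_pow n u
  have hKap : ∀ (u : (ZMod n)ˣ) (p : ℕ), p.Prime → ¬ p ∣ N → heckeEigenvalue f p ∈ K u := by
    intro u p hp hpN
    rw [hap p hp hpN]
    exact add_mem (hK u _ (hord _).1) (hK u _ (hord _).2)
  have hconj := fun u : (ZMod n)ˣ ↦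
    h274 (nebentypus f) f (hneb hf) hf0 heigen (K u) (hKap u) (τ u)
  choose ε' g hgε hg0 hgT using hconj
  -- their eigenvalues: `a_p(σ_u f) = χ₁(F_p)^u + χ₂(F_p)^u`
  have hev : ∀ (u : (ZMod n)ˣ) (p : ℕ) (hp : p.Prime), ¬ p ∣ N →
      heckeEigenvalue (g u) p =
        χ₁ (σ p hp) ^ (u : ZMod n).val + χ₂ (σ p hp) ^ (u : ZMod n).val := by
    intro u p hp hpN
    haveI : NeZero p := ⟨hp.ne_zero⟩
    rw [heckeEigenvalue_eq_of_eq_smul (hg0 u) (hgT u p hp hpN)]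
    have h1 : (⟨heckeEigenvalue f p, hKap u p hp hpN⟩ : K u) =
        ⟨χ₁ (σ p hp), hK u _ (hord _).1⟩ + ⟨χ₂ (σ p hp), hK u _ (hord _).2⟩ :=
      Subtype.ext (hap p hp hpN)
    rw [h1, map_add, hτ u _ (hord _).1, hτ u _ (hord _).2]
  have hnormev : ∀ (u : (ZMod n)ˣ) (p : ℕ) (hp : p.Prime), ¬ p ∣ N →
      ‖heckeEigenvalue (g u) p‖ ^ 2 = 2 + 2 * ((ψ (σ p hp) : ℂ) ^ (u : ZMod n).val).re := by
    intro u p hp hpN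
    rw [hev u p hp hpN, norm_add_sq_of_norm_eq_one (by rw [norm_pow, hnorm₁, one_pow])
      (by rw [norm_pow, hnorm₂, one_pow]), hψpow]
  -- (5) Rankin's bound (5.1.1) for each `σ_u(f)`
  have h51 : ∀ u : (ZMod n)ˣ, (∀ s : ℝ, 1 < s → Summable (rankinTerm (g u) s)) ∧
      ∃ C : ℝ, ∀ᶠ s : ℝ in 𝓝[>] (1 : ℝ),
        ∑' p : ℕ, rankinTerm (g u) s p ≤ Real.log (1 / (s - 1)) + C := by
    intro u
    have heigen' : ∀ p : ℕ, (hp : p.Prime) → ¬ p ∣ N →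
        ∃ a : ℂ, (haveI : NeZero p := ⟨hp.ne_zero⟩; heckeT (Gamma1 N) 1 p (g u)) = a • g u :=
      fun p hp hpN ↦ ⟨_, hgT u p hp hpN⟩
    obtain ⟨hs, C, hC⟩ := prop51_holds (ε' u) (g u) (hgε u) (hg0 u) heigen'
    simp only [Int.cast_one] at hs hC
    exact ⟨hs, C, hC⟩
  choose hsumm Cu hCu using h51
  -- (6) the image of `ψ`, a non-trivial finite subgroup of `ℂˣ`, and the subgroups `ψ(Γ)[e]`
  set Gψ := ψ.range with hGψ
  haveI : Finite Gψ := by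
    obtain ⟨F, hF⟩ := exists_image_subset_of_factors (s := Set.univ) ψ ρ (fun g _ g' _ hgg' ↦ by
      have : ρ (g' * g⁻¹) = 1 := by rw [map_mul, map_inv, ← hgg', mul_inv_cancel]
      have h := hψker _ this
      rw [map_mul, map_inv, mul_inv_eq_one] at h
      exact h.symm)
    have hfin' : (Set.range ψ).Finite := by
      rw [← Set.image_univ]
      exact ((hfin.subset (Set.image_subset_range _ _)).image F).subset hF
    exact Set.Finite.to_subtype (s := (Gψ : Set ℂˣ)) (by rw [hGψ, MonoidHom.coe_range]; exact hfin')
  letI : Fintype Gψ := Fintype.ofFinite Gψ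
  have hGψn : ∀ ω : Gψ, ((ω : ℂˣ) : ℂ) ^ n = 1 := by
    rintro ⟨_, g, rfl⟩
    exact hψn g
  have hg₀ : (⟨ψ σ₁, σ₁, rfl⟩ : Gψ) ≠ 1 := fun h ↦ hσ₁ (congrArg Subtype.val h)
  set φ : absoluteGaloisGroup ℚ →* Gψ := ψ.rangeRestrict with hφdef
  have hφsurj : Function.Surjective φ := MonoidHom.rangeRestrict_surjective ψ
  have hφval : ∀ g, ((φ g : Gψ) : ℂˣ) = ψ g := fun g ↦ rfl
  have hφker : IsOpen ((φ.ker : Subgroup (absoluteGaloisGroup ℚ)) : Set (absoluteGaloisGroup ℚ)) := by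
    have h1 : IsOpen (((ρ : absoluteGaloisGroup ℚ →* GL (Fin 2) ℂ).ker :
        Subgroup (absoluteGaloisGroup ℚ)) : Set (absoluteGaloisGroup ℚ)) := by
      have : (((ρ : absoluteGaloisGroup ℚ →* GL (Fin 2) ℂ).ker :
          Subgroup (absoluteGaloisGroup ℚ)) : Set (absoluteGaloisGroup ℚ)) = ρ ⁻¹' {1} := by
        ext τ; simp [MonoidHom.mem_ker]
      rw [this]
      exact Literature.NumberTheory.GaloisRepresentations.DeligneSerre1974.isOpen_fiber_of_finite_range ρ.continuous hfin 1
    refine Subgroup.isOpen_mono (fun τ hτ ↦ ?_) h1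
    rw [MonoidHom.mem_ker] at hτ ⊢
    exact Subtype.ext (by rw [hφval, hψker τ hτ]; rfl)
  set He : ℕ → Subgroup Gψ := fun e ↦ (powMonoidHom e : Gψ →* Gψ).ker with hHe
  have hmemHe : ∀ (e : ℕ) (ω : Gψ), ω ∈ He e ↔ ((ω : ℂˣ) : ℂ) ^ e = 1 := by
    intro e ω
    rw [hHe, MonoidHom.mem_ker, powMonoidHom_apply]
    constructor
    · intro h
      have h' := congrArg (fun x : Gψ ↦ ((x : ℂˣ) : ℂ)) h
      simpa only [SubgroupClass.coe_pow, Units.val_pow_eq_pow_val, OneMemClass.coe_one,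
        Units.val_one] using h'
    · intro h
      apply Subtype.ext
      apply Units.ext
      rw [SubgroupClass.coe_pow, Units.val_pow_eq_pow_val, OneMemClass.coe_one, Units.val_one]
      exact h
  have hcardHe : ∀ e : ℕ, (Nat.card (He e) : ℝ) =
      (Finset.univ.filter fun ω : Gψ ↦ ((ω : ℂˣ) : ℂ) ^ e = 1).card := by
    intro e
    rw [Nat.card_eq_fintype_card, Fintype.card_subtype]
    congr 2
    ext ω
    simp only [Finset.mem_filter, Finset.mem_univ, true_and]
    exact hmemHe e ω
  -- the sets `X_e = {p ∤ N : ψ(F_p)^e = 1}` and their densities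
  set Xs : ℕ → Set ℕ := fun e ↦ {p | p ∈ LFunctions.Chebotarev.frobPrimes φ (He e) ∧ ¬ p ∣ N}
    with hXs
  have hXdens : ∀ e, LFunctions.HasDirichletDensity (Xs e)
      ((Nat.card (He e) : ℝ) / Nat.card Gψ) := by
    intro e
    have h := LFunctions.Chebotarev.hasDirichletDensity_frobPrimes_subgroup φ hφker hφsurj (He e)
    refine hasDirichletDensity_of_finite (T := {p | p ∣ N}) ?_ (fun p _ hp ↦ ?_) h
    · exact (Set.finite_Iic N).subset fun p hp ↦ Nat.le_of_dvd (Nat.pos_of_neZero N) hp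
    · simp only [hXs, Set.mem_setOf_eq]
      exact ⟨fun h ↦ ⟨h, hp⟩, fun h ↦ h.1⟩
  have hmemX : ∀ (p : ℕ) (hp : p.Prime), ¬ p ∣ N → ∀ e : ℕ,
      p ∈ Xs e ↔ (ψ (σ p hp) : ℂ) ^ e = 1 := by
    intro p hp hpN e
    simp only [hXs, Set.mem_setOf_eq, hpN, not_false_eq_true, and_true]
    rw [show (ψ (σ p hp) : ℂˣ) = ((φ (σ p hp) : Gψ) : ℂˣ) from rfl, ← hmemHe e (φ (σ p hp))]
    constructor
    · rintro ⟨v, hv, -, hfrob⟩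
      have hv' : v = primesEquiv.symm ⟨p, hp⟩ := by
        apply primesEquiv.injective
        rw [Equiv.apply_symm_apply]
        exact Subtype.ext hv
      subst hv'
      exact hfrob _ (h𝔓 p hp) _ (hσ p hp)
    · intro hmem
      refine ⟨primesEquiv.symm ⟨p, hp⟩, hvp p hp, fun Q hQ τ' hτ' ↦ ?_, fun Q hQ τ' hτ' ↦ ?_⟩
      · exact Subtype.ext (by rw [hφval, hunr p hp hpN Q hQ τ' hτ']; rfl)
      · have : φ τ' = φ (σ p hp) := Subtype.ext (by rw [hφval, hφval, hconst p hp hpN Q hQ τ' hτ'])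
        rw [this]
        exact hmem
  -- (7) the Möbius weights and the vanishing of their density combination
  set w : ℕ → ℝ := fun e ↦ (ArithmeticFunction.moebius e : ℝ) * ((n / e : ℕ) : ℝ) with hw
  have hwd : ∑ e ∈ n.divisors, w e * ((Nat.card (He e) : ℝ) / Nat.card Gψ) = 0 := by
    have h0 := sum_divisors_moebius_mul_card_eq_zero hGψn hg₀
    have : ∑ e ∈ n.divisors, w e * ((Nat.card (He e) : ℝ) / Nat.card Gψ) =
        (∑ e ∈ n.divisors, (ArithmeticFunction.moebius e : ℝ) * ((n / e : ℕ) : ℝ) *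
          ((Finset.univ.filter fun ω : Gψ ↦ ((ω : ℂˣ) : ℂ) ^ e = 1).card : ℝ)) / Nat.card Gψ := by
      rw [Finset.sum_div]
      refine Finset.sum_congr rfl fun e _ ↦ ?_
      rw [hw, hcardHe e]
      ring
    rw [this, h0, zero_div]
  -- (8) the pointwise identity: `Σ_u |a_p(σ_u f)|² = 2φ(n) + 2 Σ_e μ(e)(n/e)[ψ(F_p)^e = 1]`
  set J : ℝ := (Fintype.card (ZMod n)ˣ : ℝ) with hJ
  have hJpos : 0 < J := by rw [hJ]; exact_mod_cast Fintype.card_pos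
  set T : ℝ → ℕ → ℝ := fun s p ↦ ∑ u : (ZMod n)ˣ, rankinTerm (g u) s p with hTdef
  have hpoint : ∀ (p : ℕ) (hp : p.Prime), ¬ p ∣ N →
      ∑ u : (ZMod n)ˣ, ‖heckeEigenvalue (g u) p‖ ^ 2 =
        2 * J + 2 * ∑ e ∈ n.divisors, w e * (if (ψ (σ p hp) : ℂ) ^ e = 1 then 1 else 0) := by
    intro p hp hpN
    simp_rw [hnormev _ p hp hpN]
    rw [Finset.sum_add_distrib, Finset.sum_const, Finset.card_univ, nsmul_eq_mul, ← Finset.mul_sum,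
      ← Complex.re_sum, sum_units_pow_eq_sum_divisors_moebius (hψn (σ p hp)), Complex.re_sum]
    congr 1
    · rw [hJ]; ring
    · congr 1
      refine Finset.sum_congr rfl fun e _ ↦ ?_
      rw [hw]
      split_ifs <;> simp [Complex.mul_re]
  -- (9) the contradiction
  refine false_of_rankin_bound_sum (T := T) n.divisors w Xs
    (fun e ↦ (Nat.card (He e) : ℝ) / Nat.card Gψ) (fun e _ ↦ hXdens e) hwd
    {p | ¬ p ∣ N} (hasDirichletDensity_not_dvd (NeZero.ne N)) hJpos ?_ (∑ u, Cu u) ?_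
  · -- the decomposition of `T`
    intro s hs p
    by_cases hp : p.Prime ∧ ¬ p ∣ N
    · obtain ⟨hp, hpN⟩ := hp
      have hL : T s p = (∑ u : (ZMod n)ˣ, ‖heckeEigenvalue (g u) p‖ ^ 2) * (p : ℝ) ^ (-s) := by
        rw [hTdef, Finset.sum_mul]
        exact Finset.sum_congr rfl fun u _ ↦ by simp [rankinTerm, hp, hpN]
      rw [hL, hpoint p hp hpN, if_pos ⟨hp, hpN⟩]
      simp only [hmemX p hp hpN, hp, true_and]
      rw [add_mul]
      congr 1
      rw [mul_assoc, Finset.sum_mul]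
      congr 1
      refine Finset.sum_congr rfl fun e _ ↦ ?_
      split_ifs <;> ring
    · have hL : T s p = 0 := by
        rw [hTdef]
        exact Finset.sum_eq_zero fun u _ ↦ by simp only [rankinTerm, hp, if_false]
      rw [hL]
      by_cases hp' : p.Prime
      · have hpN : p ∣ N := by
          by_contra h
          exact hp ⟨hp', h⟩
        have h2 : ∀ e, p ∉ Xs e := fun e h ↦ h.2 hpN
        simp [Set.mem_setOf_eq, hpN, h2]
      · simp [hp']
  · -- the summed Rankin bounds
    have hall : ∀ᶠ s : ℝ in 𝓝[>] (1 : ℝ), ∀ u : (ZMod n)ˣ,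
        ∑' p : ℕ, rankinTerm (g u) s p ≤ Real.log (1 / (s - 1)) + Cu u :=
      Filter.eventually_all.mpr hCu
    filter_upwards [hall, LFunctions.PrimeSum.eventually_one_lt] with s hs hs1
    rw [hTdef, Summable.tsum_finsetSum (fun u _ ↦ hsumm u s hs1)]
    calc ∑ u : (ZMod n)ˣ, ∑' p : ℕ, rankinTerm (g u) s p
        ≤ ∑ u : (ZMod n)ˣ, (Real.log (1 / (s - 1)) + Cu u) := Finset.sum_le_sum fun u _ ↦ hs u
      _ = J * Real.log (1 / (s - 1)) + ∑ u, Cu u := by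
          rw [Finset.sum_add_distrib, Finset.sum_const, Finset.card_univ, nsmul_eq_mul, hJ]

/-- **Deligne–Serre 1974, Thm. 4.1 (irreducibility) from (2.7.4) alone**: with the newform facts
`f ∈ S_1(N, ε)` and `T_p f = a_p f` discharged (`IsNewform1.mem_nebentypusSubspace_nebentypus_holds`,
`IsNewform1.heckeEigenvalue_eq_coeff_holds`), the only remaining input is `prop27_conj`
(op. cit. (2.7.4), conjugates of eigenforms). [cite: DeligneSerreASENS1974, Thm. 4.1 and Prop. 2.7 (2.7.4)] -/
theorem thm41_isIrreducible_of_prop27_conj' (h274 : prop27_conj) : thm41_isIrreducible (N := N) :=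
  thm41_isIrreducible_of_prop27_conj h274 IsNewform1.mem_nebentypusSubspace_nebentypus_holds
    IsNewform1.heckeEigenvalue_eq_coeff_holds

/-- **Deligne–Serre 1974, Thm. 4.1 (irreducibility) from (2.7.2)** (the spanning lattice of
forms with integral `q`-expansions, `DeligneSerre1974_span_integralLattice1`, all levels and
weights), through `prop27_conj_of_span_integralLattice1`. [cite: DeligneSerreASENS1974, Thm. 4.1 and Prop. 2.7 (2.7.2)] -/
theorem thm41_isIrreducible_of_span_integralLattice1
    (hL : ∀ (M : ℕ) [NeZero M] (k : ℤ), DeligneSerre1974_span_integralLattice1 M k) :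
    thm41_isIrreducible (N := N) :=
  thm41_isIrreducible_of_prop27_conj' (prop27_conj_of_span_integralLattice1 hL)

/-- **Deligne–Serre 1974, Thm. 4.1 (irreducibility) from (2.7.2) in weights `≥ 2` only**
(Shimura 1971, Thm. 3.52), the weight-one and weight-zero cases of (2.7.2) being reduced to
higher weight in the tree (`DeligneSerre1974_span_integralLattice1.of_two_le`, op. cit. Rem. 2.8).
[cite: DeligneSerreASENS1974, Thm. 4.1, Rem. 2.8 and Prop. 2.7] -/
theorem thm41_isIrreducible_of_span_integralLattice1_two_le
    (hL : ∀ (M : ℕ) [NeZero M] (k : ℤ), 2 ≤ k → DeligneSerre1974_span_integralLattice1 M k) :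
    thm41_isIrreducible (N := N) :=
  thm41_isIrreducible_of_span_integralLattice1 fun M _ k ↦
    DeligneSerre1974_span_integralLattice1.of_two_le (hL M) k

end Irreducible

end Literature.NumberTheory.EllipticCurves.ModularForms.DeligneSerre1974
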